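import Literature.Algebra.Homology.DiscreteRepLayerCohomologyMap
import Literature.Algebra.Homology.CoinducedQuotientMapsModel
import Literature.Algebra.Homology.SubgroupCohomologyConjugation
import HarnessLib

/-!
# The LAYERS of `Maps(Γ ⧸ W, M)`: `(Maps(Γ ⧸ W, M))^V = Maps((Γ⧸V) ⧸ (W⧸V), M^V)` as `Γ⧸V`-modules, with
# `R_c ↦ R_c` (Serre, *Cohomologie galoisienne* I §2.2 Prop. 8, §2.5; NSW I §6)

Topic `NumberTheory/GaloisRepresentations` (continuous cochain cohomology); namespace
`Literature.NumberTheory.GaloisRepresentations` (dot notation under `ContinuousRep`).  Definitions with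
bodies (one `Rep`-isomorphism and its two underlying maps) and theorems; no named fact, no `sorry`, no
instance, no notation.

Let `Γ` be a compact group, `W ⊴ Γ` OPEN normal, `ρ` a continuous representation of `Γ` on a discrete
`M`, `C = Maps(Γ ⧸ W, M)` the permutation model of the coinduced module (`ρ.coindOpen W hW`, diagonal
action `(g ⋆ φ)(y) = g • φ(g⁻¹ y)`; -w7 g9), and `V ⊴ Γ` an open normal subgroup with `V ≤ W`.  Since
`V` acts trivially on `Γ ⧸ W`, a function `φ : Γ ⧸ W → M` is `V`-invariant iff all its values are
(`mem_invariants_coindOpen_iff`), so the LAYER `C^V` of `C` at `V` (the `Γ⧸V`-module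
`(invariantsQuotFunctor ℤ V).obj (stdBase C)` of door-c4's colimit theorem
`Hⁿ_cont(Γ, C) = lim→_V Hⁿ(Γ⧸V, C^V)`) is the `Γ⧸V`-module of functions `(Γ⧸V) ⧸ (W⧸V) → M^V` with the
diagonal action — -w6 g9's `PermutationDual.funRep (M^V) ((Γ⧸V) ⧸ W.map (mk' V))` of
`CoinducedQuotientMapsModel` (reindexed along Noether's `(Γ⧸V)⧸(W⧸V) ≃* Γ⧸W`):

* `coindOpenLayerIso : C^V ≅ funRep (M^V) ((Γ⧸V) ⧸ (W⧸V))` in `Rep ℤ (Γ ⧸ V)` (`coindOpenLayerIso_hom_apply_coe`);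
* `coindOpenLayerIso_rTrans`: it carries the layer map `(R_c)^V` of the right translation `R_c`
  (`c ∈ Γ ⧸ W`) to -w6's `QuotientMaps.rTrans` by the corresponding element of `(Γ⧸V)⧸(W⧸V)`;
* `coindOpenHRep_extTriv_inflG_rTrans`: hence the `Δ = Γ⧸W`-action `coindOpenHRep` on
  `Hⁿ_cont(Γ, Maps(Δ, M))` acts on a layer representative `y ∈ Hⁿ(Γ⧸V, funRep (M^V) (…))` by
  `Hⁿ(rTrans)` — where -w6's `shapiroFun_map_rTrans_apply` turns it into the conjugation
  `conjRepCohomology` on `Hⁿ(W⧸V, M^V)`.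

Lane «TATE-EPC-TC» of cell `bsd-eis` (crux `GoodLatticeBDPValue`, stmt-BirchSwinnertonDyer-19032), piece
(θ-i)-top, layer half, part 2.  HONEST FRAMING: homological algebra only.

## References
* J.-P. Serre, *Cohomologie galoisienne* (1994), I §2.2 Prop. 8, §2.5. [SerreGaloisCohomology1997]
* J. Neukirch, A. Schmidt, K. Wingberg, *Cohomology of Number Fields*, 2nd ed. (2008), I §6, (1.5.1).
  [NeukirchSchmidtWingberg2008]
* K. S. Brown, *Cohomology of Groups* (1982), III §5, §8. [Brown1982CohomologyGroups]
-/

noncomputable section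

namespace Literature.NumberTheory.GaloisRepresentations

namespace ContinuousRep

open CategoryTheory Literature.Algebra.Homology Literature.Algebra.Homology.DiscreteRep
  Literature.Algebra.Homology.DiscreteRep.LayerColimit Literature.Algebra.Homology.PermutationDual
  Literature.Algebra.Homology.QuotientMaps
open _root_.TopRep _root_.ContRepresentation _root_.ContinuousCohomology

variable {G : Type} [Group G] [TopologicalSpace G] [IsTopologicalGroup G] [CompactSpace G]
variable {M : Type} [AddCommGroup M] [TopologicalSpace M] [DiscreteTopology M]
variable (ρ : ContinuousRep G ℤ M) (W : Subgroup G) [W.Normal] (hW : IsOpen (W : Set G))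
variable (V : OpenNormalSubgroup G) (hVW : (V : Subgroup G) ≤ W)
variable (hD : DiscreteTopology (ρ.coindOpen W hW).toTopRep.V)

omit [IsTopologicalGroup G] [CompactSpace G] in
/-- `M` has open stabilisers. [cite: SerreGaloisCohomology1997, I §2.1] -/
theorem isDiscrete_self : IsDiscrete ((forgetTop ℤ G).obj ρ.toTopRep) :=
  isDiscrete_of_continuousRep ρ

/-! ### §1. `V`-invariant functions are the functions with `V`-invariant values -/

omit [TopologicalSpace G] [IsTopologicalGroup G] [CompactSpace G] in
/-- A subgroup `V ≤ W` acts trivially on `Γ ⧸ W`. [cite: NeukirchSchmidtWingberg2008, I §6] -/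
theorem smul_quotient_eq_of_mem {V' : Subgroup G} (hV'W : V' ≤ W) {v : G} (hv : v ∈ V')
    (y : G ⧸ W) : v • y = y := by
  induction y using QuotientGroup.induction_on with
  | H g =>
    rw [MulAction.Quotient.smul_coe, smul_eq_mul, QuotientGroup.eq, mul_inv_rev]
    exact Subgroup.Normal.conj_mem' inferInstance _ (W.inv_mem (hV'W hv)) g

include hVW in
/-- **A function `φ : Γ ⧸ W → M` is `V`-invariant in `Maps(Γ ⧸ W, M)` iff every value `φ y` is
`V`-invariant in `M`** (`V ≤ W`). [cite: SerreGaloisCohomology1997, I §2.5] -/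
theorem mem_invariants_coindOpen_iff (φ : G ⧸ W → M) :
    φ ∈ Representation.invariants (((forgetTop ℤ G).obj (ρ.coindOpen W hW).toTopRep).ρ.comp
        (V : Subgroup G).subtype) ↔
      ∀ y, φ y ∈ Representation.invariants (((forgetTop ℤ G).obj ρ.toTopRep).ρ.comp (V : Subgroup G).subtype) := by
  simp only [Representation.mem_invariants, MonoidHom.comp_apply, Subgroup.coe_subtype, Subtype.forall]
  constructor
  · intro h y v hv
    have := congrFun (h v hv) y
    change ρ v (φ (v⁻¹ • y)) = φ y at this
    rwa [smul_quotient_eq_of_mem W hVW (V.toSubgroup.inv_mem hv)] at this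
  · intro h v hv
    funext y
    change ρ v (φ (v⁻¹ • y)) = φ y
    rw [smul_quotient_eq_of_mem W hVW (V.toSubgroup.inv_mem hv)]
    exact h y v hv

/-! ### §2. The layer of `Maps(Γ ⧸ W, M)` at `V` -/

/-- The forward map `C^V → Maps((Γ⧸V)⧸(W⧸V), M^V)`: `φ ↦ (x ↦ φ (e x))`, `e` Noether's isomorphism.
[cite: SerreGaloisCohomology1997, I §2.5] -/
def toLayerFun
    (φ : (invariantsQuotFunctor ℤ (V : Subgroup G)).obj
      (stdBase (ρ.coindOpen W hW).toTopRep (ρ.isDiscrete_coindOpen W hW))) :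
    (G ⧸ (V : Subgroup G)) ⧸ W.map (QuotientGroup.mk' (V : Subgroup G)) →
      (invariantsQuotFunctor ℤ (V : Subgroup G)).obj (stdBase ρ.toTopRep ρ.isDiscrete_self) :=
  fun x => ⟨φ.1 (QuotientGroup.quotientQuotientEquivQuotient (V : Subgroup G) W hVW x),
    (ρ.mem_invariants_coindOpen_iff W hW V hVW φ.1).1 φ.2 _⟩

/-- The backward map: `ψ ↦ (y ↦ ψ (e⁻¹ y))`. [cite: SerreGaloisCohomology1997, I §2.5] -/
def ofLayerFun
    (ψ : (G ⧸ (V : Subgroup G)) ⧸ W.map (QuotientGroup.mk' (V : Subgroup G)) →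
      (invariantsQuotFunctor ℤ (V : Subgroup G)).obj (stdBase ρ.toTopRep ρ.isDiscrete_self)) :
    (invariantsQuotFunctor ℤ (V : Subgroup G)).obj
      (stdBase (ρ.coindOpen W hW).toTopRep (ρ.isDiscrete_coindOpen W hW)) :=
  ⟨fun y => (ψ ((QuotientGroup.quotientQuotientEquivQuotient (V : Subgroup G) W hVW).symm y)).1,
    (ρ.mem_invariants_coindOpen_iff W hW V hVW _).2 fun _ => (ψ _).2⟩

/-- **The layer of `Maps(Γ ⧸ W, M)` at `V` is `Maps((Γ⧸V)⧸(W⧸V), M^V)`** as a `Γ⧸V`-module (diagonal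
actions; -w6 g9's `PermutationDual.funRep`). [cite: SerreGaloisCohomology1997, I §2.2 Prop. 8, §2.5]
[cite: NeukirchSchmidtWingberg2008, I §6] -/
def coindOpenLayerIso :
    (invariantsQuotFunctor ℤ (V : Subgroup G)).obj
        (stdBase (ρ.coindOpen W hW).toTopRep (ρ.isDiscrete_coindOpen W hW)) ≅
      funRep ((invariantsQuotFunctor ℤ (V : Subgroup G)).obj (stdBase ρ.toTopRep ρ.isDiscrete_self))
        ((G ⧸ (V : Subgroup G)) ⧸ W.map (QuotientGroup.mk' (V : Subgroup G))) :=
  Rep.mkIso (Representation.Equiv.mk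
    { toFun := ρ.toLayerFun W hW V hVW hD
      invFun := ρ.ofLayerFun W hW V hVW hD
      map_add' := fun _ _ => rfl
      map_smul' := fun _ _ => rfl
      left_inv := fun φ => Subtype.ext (funext fun y => by
        change φ.1 (QuotientGroup.quotientQuotientEquivQuotient _ W hVW
          ((QuotientGroup.quotientQuotientEquivQuotient _ W hVW).symm y)) = φ.1 y
        rw [MulEquiv.apply_symm_apply])
      right_inv := fun ψ => funext fun x => Subtype.ext (by
        change (ψ ((QuotientGroup.quotientQuotientEquivQuotient _ W hVW).symm
          (QuotientGroup.quotientQuotientEquivQuotient _ W hVW x))).1 = (ψ x).1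
        rw [MulEquiv.symm_apply_apply]) }
    fun g => LinearMap.ext fun φ => by
      induction g using QuotientGroup.induction_on with
      | H g =>
        funext x
        apply Subtype.ext
        induction x using QuotientGroup.induction_on with
        | H x =>
          induction x using QuotientGroup.induction_on with
          | H t => rfl)

/-- Formula: `(coindOpenLayerIso φ) x = φ (e x)` (values in `M^V`), `e` Noether's isomorphism.
[cite: SerreGaloisCohomology1997, I §2.5] -/
@[simp] theorem coindOpenLayerIso_hom_apply_coe
    (φ : (invariantsQuotFunctor ℤ (V : Subgroup G)).obj
      (stdBase (ρ.coindOpen W hW).toTopRep (ρ.isDiscrete_coindOpen W hW)))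
    (x : (G ⧸ (V : Subgroup G)) ⧸ W.map (QuotientGroup.mk' (V : Subgroup G))) :
    (((ρ.coindOpenLayerIso W hW V hVW hD).hom.hom φ :
        (G ⧸ (V : Subgroup G)) ⧸ W.map (QuotientGroup.mk' (V : Subgroup G)) → _) x).1 =
      φ.1 (QuotientGroup.quotientQuotientEquivQuotient (V : Subgroup G) W hVW x) := rfl

/-- **The layer iso carries `(R_c)^V` to `R_{e⁻¹ c}`**: the layer map of the right translation `R_c`
of `Maps(Γ ⧸ W, M)` (`c ∈ Γ ⧸ W`) is -w6 g9's `QuotientMaps.rTrans` by the element of `(Γ⧸V)⧸(W⧸V)`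
corresponding to `c`. [cite: NeukirchSchmidtWingberg2008, I §6] [cite: SerreLocalFields1979, VII §5] -/
theorem coindOpenLayerIso_rTrans (c : G ⧸ W) :
    (invariantsQuotFunctor ℤ (V : Subgroup G)).map
        (stdBaseMap (ρ.isDiscrete_coindOpen W hW) (ρ.isDiscrete_coindOpen W hW) (ρ.coindOpenRTrans W hW c)) ≫
        (ρ.coindOpenLayerIso W hW V hVW hD).hom =
      (ρ.coindOpenLayerIso W hW V hVW hD).hom ≫
        rTrans (W.map (QuotientGroup.mk' (V : Subgroup G))) _
          ((QuotientGroup.quotientQuotientEquivQuotient (V : Subgroup G) W hVW).symm c) := by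
  refine Rep.hom_ext (DFunLike.ext _ _ fun φ => funext fun x => Subtype.ext ?_)
  change φ.1 (QuotientGroup.quotientQuotientEquivQuotient (V : Subgroup G) W hVW x * c) =
    φ.1 (QuotientGroup.quotientQuotientEquivQuotient (V : Subgroup G) W hVW
      (x * (QuotientGroup.quotientQuotientEquivQuotient (V : Subgroup G) W hVW).symm c))
  rw [map_mul, MulEquiv.apply_symm_apply]

/-- **The `Δ = Γ⧸W`-action on layer representatives of `Hⁿ_cont(Γ, Maps(Δ, M))` is `Hⁿ(R_·)` on
`Hⁿ(Γ⧸V, Maps((Γ⧸V)⧸(W⧸V), M^V))`**: for a class `y` of the `funRep` layer, read in `C^V` through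
`coindOpenLayerIso⁻¹` and inflated,
`R_c · Φ(Inf_V (iso⁻¹ y)) = Φ(Inf_V (iso⁻¹ (Hⁿ(R_{e⁻¹ c}) y)))` — after which -w6 g9's
`QuotientMaps.shapiroFun_map_rTrans_apply` reads `Hⁿ(R_{t})` as the conjugation `conjRepCohomology t` on
`Hⁿ(W⧸V, M^V)`. [cite: NeukirchSchmidtWingberg2008, I §6, (1.5.1)] [cite: SerreLocalFields1979, VII §5] -/
theorem coindOpenHRep_extTriv_inflG_rTrans (n : ℕ) (c : G ⧸ W)
    (y : groupCohomology (funRep ((invariantsQuotFunctor ℤ (V : Subgroup G)).obj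
      (stdBase ρ.toTopRep ρ.isDiscrete_self))
        ((G ⧸ (V : Subgroup G)) ⧸ W.map (QuotientGroup.mk' (V : Subgroup G)))) n) :
    ρ.coindOpenHRep W hW n c
        (extTrivAddEquivContinuousCohomology (ρ.coindOpen W hW).toTopRep (ρ.isDiscrete_coindOpen W hW) n
          (inflG V _ n ((groupCohomology.map (MonoidHom.id _) (ρ.coindOpenLayerIso W hW V hVW hD).inv n).hom y))) =
      extTrivAddEquivContinuousCohomology (ρ.coindOpen W hW).toTopRep (ρ.isDiscrete_coindOpen W hW) n
        (inflG V _ n ((groupCohomology.map (MonoidHom.id _) (ρ.coindOpenLayerIso W hW V hVW hD).inv n).hom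
          ((groupCohomology.map (MonoidHom.id _)
            (rTrans (W.map (QuotientGroup.mk' (V : Subgroup G))) _
              ((QuotientGroup.quotientQuotientEquivQuotient (V : Subgroup G) W hVW).symm c)) n).hom y))) := by
  rw [ρ.coindOpenHRep_extTriv_inflG W hW hD V n c]
  congr 2
  -- `(R_c)^V ∘ iso⁻¹ = iso⁻¹ ∘ R_{e⁻¹ c}` on the layer, then functoriality of `Hⁿ(Γ⧸V, ·)`
  have hcomm : (ρ.coindOpenLayerIso W hW V hVW hD).inv ≫
      (invariantsQuotFunctor ℤ (V : Subgroup G)).map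
        (stdBaseMap (ρ.isDiscrete_coindOpen W hW) (ρ.isDiscrete_coindOpen W hW) (ρ.coindOpenRTrans W hW c)) =
      rTrans (W.map (QuotientGroup.mk' (V : Subgroup G))) _
          ((QuotientGroup.quotientQuotientEquivQuotient (V : Subgroup G) W hVW).symm c) ≫
        (ρ.coindOpenLayerIso W hW V hVW hD).inv := by
    rw [Iso.inv_comp_eq, ← Category.assoc, ← ρ.coindOpenLayerIso_rTrans W hW V hVW hD c, Category.assoc,
      Iso.hom_inv_id, Category.comp_id]
  have h := groupCohomology.map_id_comp (ρ.coindOpenLayerIso W hW V hVW hD).inv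
    ((invariantsQuotFunctor ℤ (V : Subgroup G)).map
      (stdBaseMap (ρ.isDiscrete_coindOpen W hW) (ρ.isDiscrete_coindOpen W hW) (ρ.coindOpenRTrans W hW c))) n
  rw [hcomm, groupCohomology.map_id_comp] at h
  have h2 := congrArg (fun f => (ModuleCat.Hom.hom f) y) h
  simp only [ModuleCat.hom_comp, LinearMap.comp_apply] at h2
  exact h2.symm

omit [TopologicalSpace G] [IsTopologicalGroup G] [CompactSpace G] in
/-- Noether's isomorphism, inverted on a class: `e⁻¹ (g W) = (g V) (W/V)`. [folklore] -/
private theorem quotientQuotientEquivQuotient_symm_mk (V' : Subgroup G) [V'.Normal] (h : V' ≤ W) (g : G) :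
    (QuotientGroup.quotientQuotientEquivQuotient V' W h).symm (g : G ⧸ W) =
      ((g : G ⧸ V') : (G ⧸ V') ⧸ W.map (QuotientGroup.mk' V')) :=
  (MulEquiv.symm_apply_eq _).2 (QuotientGroup.quotientQuotientEquivQuotientAux_mk_mk V' W h g).symm

/-- **THE `Δ`-ACTION ON LAYER REPRESENTATIVES, conjugation form.**  For `g ∈ Γ` and a class `y` of the
`funRep`-layer `Hⁿ(Γ⧸V, Maps((Γ⧸V)⧸(W⧸V), M^V))`, set `y′ := Hⁿ(R_{(gV)(W/V)}) y`.  Then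
`R_{gW} · Φ(Inf_V (iso⁻¹ y)) = Φ(Inf_V (iso⁻¹ y′))` in `Hⁿ_cont(Γ, Maps(Γ⧸W, M))`, and the finite
Shapiro map (-w6 g9's `QuotientMaps.shapiroFun`, `Hⁿ(Γ⧸V, Maps(…)) → Hⁿ(W⧸V, M^V)`) carries `y′` to the
CONJUGATE `σ_{gV} (Sh y)` of `Sh y` (tree `conjRepCohomology` of `SubgroupCohomologyConjugation`):
the right-translation action of `Δ` on `Hⁿ_cont(Γ, Maps(Δ, M))` is, on layer representatives read in
`Hⁿ(W⧸V, M^V)`, the conjugation action of `Γ⧸V ⊇ W⧸V`.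
[cite: SerreLocalFields1979, VII §5] [cite: NeukirchSchmidtWingberg2008, I §6 Prop. (1.6.5)]
[cite: Brown1982CohomologyGroups, III §8 (8.3)] -/
theorem coindOpenHRep_layer_conj (n : ℕ) (g : G)
    (y : groupCohomology (funRep ((invariantsQuotFunctor ℤ (V : Subgroup G)).obj
      (stdBase ρ.toTopRep ρ.isDiscrete_self))
        ((G ⧸ (V : Subgroup G)) ⧸ W.map (QuotientGroup.mk' (V : Subgroup G)))) n) :
    ρ.coindOpenHRep W hW n (g : G ⧸ W)
        (extTrivAddEquivContinuousCohomology (ρ.coindOpen W hW).toTopRep (ρ.isDiscrete_coindOpen W hW) n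
          (inflG V _ n ((groupCohomology.map (MonoidHom.id _) (ρ.coindOpenLayerIso W hW V hVW hD).inv n).hom y))) =
      extTrivAddEquivContinuousCohomology (ρ.coindOpen W hW).toTopRep (ρ.isDiscrete_coindOpen W hW) n
        (inflG V _ n ((groupCohomology.map (MonoidHom.id _) (ρ.coindOpenLayerIso W hW V hVW hD).inv n).hom
          ((groupCohomology.map (MonoidHom.id _)
            (rTrans (W.map (QuotientGroup.mk' (V : Subgroup G))) _
              (((g : G ⧸ (V : Subgroup G)) : (G ⧸ (V : Subgroup G)) ⧸ W.map (QuotientGroup.mk' (V : Subgroup G)))))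
            n).hom y))) ∧
    (QuotientMaps.shapiroFun (W.map (QuotientGroup.mk' (V : Subgroup G))) _ n).hom
        ((groupCohomology.map (MonoidHom.id _)
          (rTrans (W.map (QuotientGroup.mk' (V : Subgroup G))) _
            (((g : G ⧸ (V : Subgroup G)) : (G ⧸ (V : Subgroup G)) ⧸ W.map (QuotientGroup.mk' (V : Subgroup G)))))
          n).hom y) =
      conjRepCohomology (W.map (QuotientGroup.mk' (V : Subgroup G))) _ n (g : G ⧸ (V : Subgroup G))
        ((QuotientMaps.shapiroFun (W.map (QuotientGroup.mk' (V : Subgroup G))) _ n).hom y) := by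
  refine ⟨?_, ?_⟩
  · have h := ρ.coindOpenHRep_extTriv_inflG_rTrans W hW V hVW hD n (g : G ⧸ W) y
    rwa [quotientQuotientEquivQuotient_symm_mk W (V : Subgroup G) hVW g] at h
  · rw [conjRepCohomology_apply]
    exact QuotientMaps.shapiroFun_map_rTrans_apply _ _ (g : G ⧸ (V : Subgroup G)) (conj_mem_of_normal _ _) n y

end ContinuousRep

end Literature.NumberTheory.GaloisRepresentations

end
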